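import Summits.Langlands.Langlands.Theses.MirrorPairReflection

/-!
# BC3 birth skeleton — child `WeakAutomorphyOffSector` of the BC2-redirect split of `MirrorPairReflection.SectorComplement`
(crux stmt-Langlands-12840; crux-strategist `cstrat-stmt-Langlands-12840-r1`, 2026-08-17)

`WeakAutomorphyOffSector` (B_w⁻ — Fontaine–Mazur–Langlands, a.e. form, for irreducible pinned-geometric `ρ` OUTSIDE X's sector
`[K:ℚ] = 1 ∧ n = 2 ∧ ℓ ≠ 2 ∧ ρ unramified outside ℓ ∧ ρ̄^ss = ω^a ⊕ ω^b with a + b even`; VERBATIM the registered stub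
`stub_weakAutomorphyOffSector` of line birth_MirrorPairReflection).  Cut by RANK/FIELD: (O₁) the rank-two-over-ℚ world off the
sector — odd `ρ` (Kisin 2009, Emerton, Pan 2022, HT (0,0): Pan Thm 1.0.4), even `ρ` with irreducible residue or ramification
away from `ℓ`, `ℓ = 2` — where the whole `p`-adic Langlands / patching technology for `GL₂(ℚ_p)` lives; (O₂) every other
`(K, n)`: `GL₁` (class field theory + Weil), `n ≥ 3` (BLGGT, ACC+ 2023 over CM), `K ≠ ℚ` (Hilbert/Bianchi and beyond) —
the far side of ShimuraVarietyRealizationBarrier / TwistedEndoscopySelfDual.  Both open; neither is the child (O₁ misses all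
`n ≠ 2`, O₂ misses `GL₂/ℚ`), neither is the summit.

Shape: ≥ 2 NAMED stubs `stub_*` (the ONLY sorries of this file) and the kernel-checked composition
`WeakAutomorphyOffSector_of : <stub₁-sig> → <stub₂-sig> → WeakAutomorphyOffSector` (+ `WeakAutomorphyOffSector_of_stubs`).  Context = the route file's
(the child is restated here VERBATIM from children.json; after `route edit --split` it is the route's own decl
`Summit.Langlands.Langlands.Theses.MirrorPairReflection.WeakAutomorphyOffSector` and this local copy is deleted — post-split
version `post/birth_WeakAutomorphyOffSector.lean` in the planner folder).
-/

noncomputable section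

set_option linter.dupNamespace false

namespace Summit.Langlands.Langlands.Theses.MirrorPairReflection

open scoped BigOperators Topology Manifold Classical MeasureTheory ProbabilityTheory Matrix InnerProductSpace ComplexConjugate ContinuousMap
open Filter Set Function TopologicalSpace MeasureTheory

/-- child `WeakAutomorphyOffSector` (children.json statement VERBATIM). -/
def WeakAutomorphyOffSector : Prop :=
  ∀ (K : Type) [Field K] [NumberField K] (n : ℕ) (hcpt : Literature.NumberTheory.Automorphic.isCompact_glFiniteIntegralLevel n K), 0 < n → ∀ (ℓ : ℕ) [Fact ℓ.Prime] (ι : PadicAlgCl ℓ ≃+* ℂ) (ρ : Literature.NumberTheory.GaloisRepresentations.FramedGaloisRep K (PadicAlgCl ℓ) n), ρ.toGaloisRep.IsIrreducible → ((∀ᶠ v : IsDedekindDomain.HeightOneSpectrum (NumberField.RingOfIntegers K) in cofinite, ρ.IsUnramifiedAt v) ∧ ∀ (v : IsDedekindDomain.HeightOneSpectrum (NumberField.RingOfIntegers K)) (hv : ((ℓ : ℕ) : NumberField.RingOfIntegers K) ∈ v.asIdeal), (Literature.NumberTheory.PAdicHodge.fontainePstAdicCompletion v ℓ hv).IsDeRhamFramed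 (ρ.toLocal v)) → ¬ (Module.finrank ℚ K = 1 ∧ n = 2 ∧ ℓ ≠ 2 ∧ (∀ v : IsDedekindDomain.HeightOneSpectrum (NumberField.RingOfIntegers K), ((ℓ : ℕ) : NumberField.RingOfIntegers K) ∉ v.asIdeal → ρ.IsUnramifiedAt v) ∧ ∃ a b : ℕ, Even (a + b) ∧ ∀ g : Field.absoluteGaloisGroup K, ‖Literature.NumberTheory.GaloisRepresentations.FramedRep.trace ρ g - ((algebraMap ℚ_[ℓ] (PadicAlgCl ℓ) (((Literature.NumberTheory.GaloisRepresentations.GaloisRep.cyclotomicCharacter K ℓ g : ℤ_[ℓ]ˣ) : ℤ_[ℓ]) : ℚ_[ℓ])) ^ a + (algebraMap ℚ_[ℓ] (PadicAlgCl ℓ) (((Literature.NumberTheory.GaloisRepresentations.GaloisRep.cyclotomicCharacter K ℓ g : ℤ_[ℓ]ˣ) : ℤ_[ℓ]) : ℚ_[ℓ])) ^ b)‖ < 1) → ∃ π : Literature.NumberTheory.Automorphic.CuspidalAutomorphicRepData n K hcpt, π.1.IsLAlgebraic ∧ ∀ᶠ v : IsDedekindDomain.HeightOneSpectrum (NumberField.RingOfIntegers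 K) in cofinite, SatakeFrobCompatibleAt ι π.1 ρ v

namespace Cruxes.WeakAutomorphyOffSector.Birth

/-- **stub O₁ (OPEN in part: weak automorphy for `GL₂` over `K ≃ ℚ` OFF X's sector)** — irreducible pinned-geometric
`ρ : Γ_K → GL₂(ℚ̄_ℓ)`, `[K:ℚ] = 1`, NOT in the sector (so: odd — Kisin 2009 / Emerton / Pan 2022 Thm 1.0.4 —, or even with
irreducible residue or extra ramification or `ℓ = 2` — open), is Satake–Frobenius compatible a.e. with an L-algebraic
cuspidal `π` of `GL₂(𝔸_K)`.  Why it might fail: it contains even Fontaine–Mazur for irreducible residue (Calegari 2011 only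
for `p > 7`, ordinary-distinguished cases).  [cite: Pan2022, Thm. 1.0.4] [cite: Kisin2009FM, Thm.] [cite: Calegari2011, Thm. 1.1] -/
theorem stub_offSector_rankTwoOverQ :
    ∀ (K : Type) [Field K] [NumberField K] (n : ℕ) (hcpt : Literature.NumberTheory.Automorphic.isCompact_glFiniteIntegralLevel n K), 0 < n → ∀ (ℓ : ℕ) [Fact ℓ.Prime] (ι : PadicAlgCl ℓ ≃+* ℂ) (ρ : Literature.NumberTheory.GaloisRepresentations.FramedGaloisRep K (PadicAlgCl ℓ) n), ρ.toGaloisRep.IsIrreducible → ((∀ᶠ v : IsDedekindDomain.HeightOneSpectrum (NumberField.RingOfIntegers K) in cofinite, ρ.IsUnramifiedAt v) ∧ ∀ (v : IsDedekindDomain.HeightOneSpectrum (NumberField.RingOfIntegers K)) (hv : ((ℓ : ℕ) : NumberField.RingOfIntegers K) ∈ v.asIdeal), (Literature.NumberTheory.PAdicHodge.fontainePstAdicCompletion v ℓ hv).IsDeRhamFramed (ρ.toLocal v)) → (Module.finrank ℚ K = 1 ∧ n = 2) → ¬ (Module.finrank ℚ K = 1 ∧ n = 2 ∧ ℓ ≠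 2 ∧ (∀ v : IsDedekindDomain.HeightOneSpectrum (NumberField.RingOfIntegers K), ((ℓ : ℕ) : NumberField.RingOfIntegers K) ∉ v.asIdeal → ρ.IsUnramifiedAt v) ∧ ∃ a b : ℕ, Even (a + b) ∧ ∀ g : Field.absoluteGaloisGroup K, ‖Literature.NumberTheory.GaloisRepresentations.FramedRep.trace ρ g - ((algebraMap ℚ_[ℓ] (PadicAlgCl ℓ) (((Literature.NumberTheory.GaloisRepresentations.GaloisRep.cyclotomicCharacter K ℓ g : ℤ_[ℓ]ˣ) : ℤ_[ℓ]) : ℚ_[ℓ])) ^ a + (algebraMap ℚ_[ℓ] (PadicAlgCl ℓ) (((Literature.NumberTheory.GaloisRepresentations.GaloisRep.cyclotomicCharacter K ℓ g : ℤ_[ℓ]ˣ) : ℤ_[ℓ]) : ℚ_[ℓ])) ^ b)‖ < 1) → ∃ π : Literature.NumberTheory.Automorphic.CuspidalAutomorphicRepData n K hcpt, π.1.IsLAlgebraic ∧ ∀ᶠ v : IsDedekindDomain.HeightOneSpectrum (NumberField.RingOfIntegers K) in cofinite, SatakeFrobCompatibleAt ι π.1 ρ v := by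
  sorry

/-- **stub O₂ (OPEN: weak automorphy in every other rank / over every other field)** — irreducible pinned-geometric
`ρ : Γ_K → GL_n(ℚ̄_ℓ)` with `¬ ([K:ℚ] = 1 ∧ n = 2)`: `GL₁` (class field theory + Weil 1956), `n ≥ 3` (BLGGT 2014, ACC+ 2023
over CM fields under genericity), `K ≠ ℚ` (Hilbert / Bianchi modularity lifting and beyond); open in general
(ShimuraVarietyRealizationBarrier, TwistedEndoscopySelfDual, NonRegularWeightBarrier).
[cite: FontaineMazurGeometric1995, Conj. 1] [cite: BarnetlambEtAl2014, Thm. A] [cite: ACCGHLNSTT2023, Thm. 1.0.1] -/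
theorem stub_offSector_otherRanksAndFields :
    ∀ (K : Type) [Field K] [NumberField K] (n : ℕ) (hcpt : Literature.NumberTheory.Automorphic.isCompact_glFiniteIntegralLevel n K), 0 < n → ∀ (ℓ : ℕ) [Fact ℓ.Prime] (ι : PadicAlgCl ℓ ≃+* ℂ) (ρ : Literature.NumberTheory.GaloisRepresentations.FramedGaloisRep K (PadicAlgCl ℓ) n), ρ.toGaloisRep.IsIrreducible → ((∀ᶠ v : IsDedekindDomain.HeightOneSpectrum (NumberField.RingOfIntegers K) in cofinite, ρ.IsUnramifiedAt v) ∧ ∀ (v : IsDedekindDomain.HeightOneSpectrum (NumberField.RingOfIntegers K)) (hv : ((ℓ : ℕ) : NumberField.RingOfIntegers K) ∈ v.asIdeal), (Literature.NumberTheory.PAdicHodge.fontainePstAdicCompletion v ℓ hv).IsDeRhamFramed (ρ.toLocal v)) → ¬ (Module.finrank ℚ K = 1 ∧ n = 2) → ∃ π : Literature.NumberTheory.Automorphic.CuspidalAutomorphicRepData n K hcpt, π.1.IsLAlgebraic ∧ ∀ᶠ v : IsDedekindDomain.HeightOneSpectrum (NumberField.RingOfIntegers K) in cofinite, SatakeFrobCompatibleAt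 ι π.1 ρ v := by
  sorry

/-- **B_w⁻ from its two stubs** (case split on `[K:ℚ] = 1 ∧ n = 2`). -/
theorem WeakAutomorphyOffSector_of :
    (∀ (K : Type) [Field K] [NumberField K] (n : ℕ) (hcpt : Literature.NumberTheory.Automorphic.isCompact_glFiniteIntegralLevel n K), 0 < n → ∀ (ℓ : ℕ) [Fact ℓ.Prime] (ι : PadicAlgCl ℓ ≃+* ℂ) (ρ : Literature.NumberTheory.GaloisRepresentations.FramedGaloisRep K (PadicAlgCl ℓ) n), ρ.toGaloisRep.IsIrreducible → ((∀ᶠ v : IsDedekindDomain.HeightOneSpectrum (NumberField.RingOfIntegers K) in cofinite, ρ.IsUnramifiedAt v) ∧ ∀ (v : IsDedekindDomain.HeightOneSpectrum (NumberField.RingOfIntegers K)) (hv : ((ℓ : ℕ) : NumberField.RingOfIntegers K) ∈ v.asIdeal), (Literature.NumberTheory.PAdicHodge.fontainePstAdicCompletion v ℓ hv).IsDeRhamFramed (ρ.toLocal v)) → (Module.finrank ℚ K = 1 ∧ n = 2) → ¬ (Module.finrank ℚ K = 1 ∧ n = 2 ∧ ℓ ≠ 2 ∧ (∀ v : IsDedekindDomain.HeightOneSpectrum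 (NumberField.RingOfIntegers K), ((ℓ : ℕ) : NumberField.RingOfIntegers K) ∉ v.asIdeal → ρ.IsUnramifiedAt v) ∧ ∃ a b : ℕ, Even (a + b) ∧ ∀ g : Field.absoluteGaloisGroup K, ‖Literature.NumberTheory.GaloisRepresentations.FramedRep.trace ρ g - ((algebraMap ℚ_[ℓ] (PadicAlgCl ℓ) (((Literature.NumberTheory.GaloisRepresentations.GaloisRep.cyclotomicCharacter K ℓ g : ℤ_[ℓ]ˣ) : ℤ_[ℓ]) : ℚ_[ℓ])) ^ a + (algebraMap ℚ_[ℓ] (PadicAlgCl ℓ) (((Literature.NumberTheory.GaloisRepresentations.GaloisRep.cyclotomicCharacter K ℓ g : ℤ_[ℓ]ˣ) : ℤ_[ℓ]) : ℚ_[ℓ])) ^ b)‖ < 1) → ∃ π : Literature.NumberTheory.Automorphic.CuspidalAutomorphicRepData n K hcpt, π.1.IsLAlgebraic ∧ ∀ᶠ v : IsDedekindDomain.HeightOneSpectrum (NumberField.RingOfIntegers K) in cofinite, SatakeFrobCompatibleAt ι π.1 ρ v) →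
    (∀ (K : Type) [Field K] [NumberField K] (n : ℕ) (hcpt : Literature.NumberTheory.Automorphic.isCompact_glFiniteIntegralLevel n K), 0 < n → ∀ (ℓ : ℕ) [Fact ℓ.Prime] (ι : PadicAlgCl ℓ ≃+* ℂ) (ρ : Literature.NumberTheory.GaloisRepresentations.FramedGaloisRep K (PadicAlgCl ℓ) n), ρ.toGaloisRep.IsIrreducible → ((∀ᶠ v : IsDedekindDomain.HeightOneSpectrum (NumberField.RingOfIntegers K) in cofinite, ρ.IsUnramifiedAt v) ∧ ∀ (v : IsDedekindDomain.HeightOneSpectrum (NumberField.RingOfIntegers K)) (hv : ((ℓ : ℕ) : NumberField.RingOfIntegers K) ∈ v.asIdeal), (Literature.NumberTheory.PAdicHodge.fontainePstAdicCompletion v ℓ hv).IsDeRhamFramed (ρ.toLocal v)) → ¬ (Module.finrank ℚ K = 1 ∧ n = 2) → ∃ π : Literature.NumberTheory.Automorphic.CuspidalAutomorphicRepData n K hcpt, π.1.IsLAlgebraic ∧ ∀ᶠ v : IsDedekindDomain.HeightOneSpectrum (NumberField.RingOfIntegers K) in cofinite, SatakeFrobCompatibleAt ι π.1 ρ v) 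→
    WeakAutomorphyOffSector := by
  intro h1 h2 K _ _ n hcpt hn ℓ _ ι ρ hirr hgeo hs
  by_cases hK : (Module.finrank ℚ K = 1 ∧ n = 2)
  · exact h1 K n hcpt hn ℓ ι ρ hirr hgeo hK hs
  · exact h2 K n hcpt hn ℓ ι ρ hirr hgeo hK

/-- The composition with the stubs plugged in. -/
theorem WeakAutomorphyOffSector_of_stubs : WeakAutomorphyOffSector :=
  WeakAutomorphyOffSector_of stub_offSector_rankTwoOverQ stub_offSector_otherRanksAndFields

end Cruxes.WeakAutomorphyOffSector.Birth

end Summit.Langlands.Langlands.Theses.MirrorPairReflection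

end
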